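import Summits.QuantumFields.YangMills.Theorems.SoloBlindClusteringReflected

/-!
# Line `beta-slope-floor` (crux `IR`, stmt-QuantumFields-19354): from reflected antipodal decay of every species to `GapInUnits`

Route `BalabanLadder`, crux `IR`, line `beta-slope-floor` (ideator ym-ir-idea-2), lead prover `ym-ir-line-bsf-p1`.
The line's class-reduction seam, in the form the tree's reflection-positivity machinery actually delivers
(`SoloBlindClusteringReflected`, rung D8 part 12): on the statement's own odd tori, decay IN UNITS `a(β)` of the
two REFLECTED antipodal clauses `c_{ΘA,A}(S; S)`, `c_{A,ΘA}(S; S)` of every species `A` (`Θ` = site time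
reflection, `A.timeReflect`), with per-species constants and a rate `c₁ · a(β)` uniform in `β ≥ β₂` and in the
volume `S ≥ S₁ β`, implies the crux's conclusion `GapInUnits G r a` (all pairs, all `n ≤ S`, same rate).

* §1 `abs_latticeConnectedCorr_le_of_reflected_unif` — the single-torus inequality of part 12 with the constant
  made UNIFORM IN THE RATE: one `K` serves every rate `0 ≤ μ ≤ M` (the part-12 constant grows like `e^{μ(2T+1)}`;
  we build it at `M`).  Proof = part 12's (PSD Hankel structure of the OS pairing along odd separations, endpoint
  interpolation, OS Schwarz), adapted.
* §2 `stub_speciesToPairs` — the registered stub of the reshaped skeleton, with the skeleton's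
  `ReflAntipodalDecay` and the crux's `GapInUnits` (`DlrCollarTransfer.GapInUnits`, verbatim body) δ-unfolded: `(∀ β, 0 < a β) → Tendsto a atTop (𝓝 0) → ReflAntipodalDecay r a → GapInUnits G r a`.
  `Tendsto a atTop (𝓝 0)` (a hypothesis of `IR` itself) bounds the rate `c₁ a(β) ≤ c₁` for large `β`, which is
  what makes the constants `β`-free on tori smaller than the pair's slab heights; without it the seam is not
  provable (this is why the original `stub_classReduction`, typed with `(∀ β, 0 < a β)` only, was reshaped).

Group-blind, carries no gap content (it holds verbatim for `U(1)`); nothing here proves the Yang–Mills mass gap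
(Clay); R4 closes only the conditional finite-𝕋⁴ rung `BalabanLadder.UV`.
Refs: E. Seiler, LNP 159 (1982) Ch. 2; K. Osterwalder, E. Seiler, Ann. Phys. 110 (1978) §2 (reflection positivity,
transfer matrix); tree `SoloBlindClusteringReflected`, `SoloBlindOddTorusSlabDecay`, `SoloBlindSpeciesSlab`.
-/

set_option autoImplicit false

noncomputable section

open MeasureTheory Filter Topology
open Literature.MathematicalPhysics.QuantumFieldTheory Literature.MathematicalPhysics.QuantumLattice
open Summit.QuantumFields.YangMills.Theorems.SoloBlind

namespace Summit.QuantumFields.YangMills.Cruxes.IR.BetaSlopeFloor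

variable {G : Type} [Group G] [TopologicalSpace G] [IsTopologicalGroup G] [CompactSpace G]
  [MeasurableSpace G] [BorelSpace G]

/-! ## §0 Arithmetic of the constants (as in part 12) -/

/-- Low index: `x ≤ q ≤ (max C 0 + q)(E t)` when `q ≥ 0`, `E t ≥ 1`. -/
private theorem le_K_low {C q E t x : ℝ} (hq : 0 ≤ q) (hx : x ≤ q) (hEt : 1 ≤ E * t) :
    x ≤ (max C 0 + q) * E * t := by
  have h0 : 0 ≤ max C 0 + q := add_nonneg (le_max_right _ _) hq
  calc x ≤ (max C 0 + q) * 1 := by linarith [le_max_right C 0]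
    _ ≤ (max C 0 + q) * (E * t) := mul_le_mul_of_nonneg_left hEt h0
    _ = (max C 0 + q) * E * t := by ring

/-- Antipode: `x ≤ C p ≤ (max C 0 + q) E p` when `q ≥ 0`, `E ≥ 1`, `p ≥ 0`. -/
private theorem le_K_mid {C q E p x : ℝ} (hq : 0 ≤ q) (hE : 1 ≤ E) (hp : 0 ≤ p)
    (hx : x ≤ C * p) : x ≤ (max C 0 + q) * E * p := by
  have h0 : 0 ≤ max C 0 + q := add_nonneg (le_max_right _ _) hq
  calc x ≤ C * p := hx
    _ ≤ (max C 0 + q) * 1 * p := by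
        apply mul_le_mul_of_nonneg_right _ hp; linarith [le_max_left C 0]
    _ ≤ (max C 0 + q) * E * p :=
        mul_le_mul_of_nonneg_right (mul_le_mul_of_nonneg_left hE h0) hp

/-- Past the antipode: `x ≤ C p ≤ (max C 0 + q) E (p θ)` when `q ≥ 0`, `E θ ≥ 1`, `p ≥ 0`. -/
private theorem le_K_succ {C q E p θ x : ℝ} (hq : 0 ≤ q) (hEθ : 1 ≤ E * θ) (hp : 0 ≤ p)
    (hx : x ≤ C * p) : x ≤ (max C 0 + q) * E * (p * θ) := by
  have h0 : 0 ≤ max C 0 + q := add_nonneg (le_max_right _ _) hq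
  calc x ≤ C * p := hx
    _ ≤ (max C 0 + q) * 1 * p := by
        apply mul_le_mul_of_nonneg_right _ hp; linarith [le_max_left C 0]
    _ ≤ (max C 0 + q) * (E * θ) * p :=
        mul_le_mul_of_nonneg_right (mul_le_mul_of_nonneg_left hEθ h0) hp
    _ = (max C 0 + q) * E * (p * θ) := by ring

/-! ## §1 The single-torus reduction with a rate-uniform constant -/

/-- **Single-torus reduction to the reflected antipodal correlators, uniformly in the rate and the coupling**
(`β ≥ 0`, every compact `G`, continuous `ρ`).  For slab species `A` (`[-T'_A, T_A]`) and `B` (`[-T'_B, T_B]`) with sup norms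
`a₀, b₀`, constants `C_A, C_B` and a rate CEILING `M` there is ONE constant `K` such that for EVERY rate
`0 ≤ μ ≤ M`, on every odd torus `(2S+1)⁴` with `S ≥ 2(T_A+T'_A+T_B+T'_B)+2`: if
`c_{ΘA,A}(S), c_{A,ΘA}(S) ≤ C_A e^{-μS}` and `c_{ΘB,B}(S), c_{B,ΘB}(S) ≤ C_B e^{-μS}`, then
`|c_{A,B}(n; S)| ≤ K e^{-μ n}` for every `n ≤ S`.  (Part 12's `exists_const_abs_latticeConnectedCorr_le` with its
constant, which grows like `e^{μ(2T+1)}`, built at the ceiling `M`.) -/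
theorem abs_latticeConnectedCorr_le_of_reflected_unif {N : ℕ} (ρ : G →* Matrix (Fin N) (Fin N) ℂ)
    (hρ : Continuous ρ) {A B : YMSpecies G} {TA' TA TB' TB : ℕ}
    (hA : IsSlabSupported TA' TA A) (hB : IsSlabSupported TB' TB B) {a0 b0 : ℝ}
    (ha0 : ∀ U, |A.F U| ≤ a0) (hb0 : ∀ U, |B.F U| ≤ b0) (M CA CB : ℝ) :
    ∃ K : ℝ, ∀ β : ℝ, 0 ≤ β → ∀ μ : ℝ, 0 ≤ μ → μ ≤ M → ∀ S : ℕ, 2 * (TA + TA' + TB + TB') + 2 ≤ S →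
      latticeConnectedCorr ρ β (2 * S + 1) A.timeReflect.F A.F S ≤ CA * Real.exp (-(μ * S)) →
      latticeConnectedCorr ρ β (2 * S + 1) A.F A.timeReflect.F S ≤ CA * Real.exp (-(μ * S)) →
      latticeConnectedCorr ρ β (2 * S + 1) B.timeReflect.F B.F S ≤ CB * Real.exp (-(μ * S)) →
      latticeConnectedCorr ρ β (2 * S + 1) B.F B.timeReflect.F S ≤ CB * Real.exp (-(μ * S)) →
      ∀ n : ℕ, n ≤ S →
        |latticeConnectedCorr ρ β (2 * S + 1) A.F B.F n| ≤ K * Real.exp (-(μ * n)) := by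
  -- adapted from Summit.QuantumFields.YangMills.Theorems.SoloBlind.exists_const_abs_latticeConnectedCorr_le
  have ha0' : ∀ U, |A.timeReflect.F U| ≤ a0 := fun U => by simpa using ha0 (cfgReflect U)
  have hb0' : ∀ U, |B.timeReflect.F U| ≤ b0 := fun U => by simpa using hb0 (cfgReflect U)
  set KA : ℝ := (max CA 0 + 2 * (a0 * a0)) * Real.exp (M * (2 * TA + 1 : ℕ)) with hKA
  set KB : ℝ := (max CB 0 + 2 * (b0 * b0)) * Real.exp (M * (2 * TB' + 1 : ℕ)) with hKB
  have haa : 0 ≤ 2 * (a0 * a0) := mul_nonneg two_pos.le (mul_self_nonneg a0)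
  have hbb : 0 ≤ 2 * (b0 * b0) := mul_nonneg two_pos.le (mul_self_nonneg b0)
  refine ⟨max (Real.sqrt (KA * KB)) (2 * (a0 * b0) * Real.exp (M * (2 * (TA + TB') + 2 : ℕ))),
    fun β hβ μ hμ hμM S hS hA1 hA2 hB1 hB2 n hn => ?_⟩
  have hS1 : 1 ≤ S := by omega
  -- the ratio `θ = e^{-μ} ∈ (0, 1]`
  set θ : ℝ := Real.exp (-μ) with hθdef
  have hθ : 0 < θ := Real.exp_pos _
  have hθpow : ∀ j : ℕ, Real.exp (-(μ * j)) = θ ^ j := fun j => by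
    rw [hθdef, ← Real.exp_nat_mul]; ring_nf
  have hθS : 0 ≤ θ ^ S := pow_nonneg hθ.le _
  -- `1 ≤ e^{M N} θ^j` for `j ≤ N` (uses `μ ≤ M`), and `1 ≤ e^{M N}`
  have hlow : ∀ {j N₁ : ℕ}, j ≤ N₁ → 1 ≤ Real.exp (M * N₁) * θ ^ j := by
    intro j N₁ hj
    rw [← hθpow, ← Real.exp_add]
    apply Real.one_le_exp
    have h1 : μ * (j : ℝ) ≤ μ * N₁ := mul_le_mul_of_nonneg_left (by exact_mod_cast hj) hμ
    have h2 : μ * (N₁ : ℝ) ≤ M * N₁ := mul_le_mul_of_nonneg_right hμM (Nat.cast_nonneg _)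
    linarith
  have hE1 : ∀ N₁ : ℕ, (1 : ℝ) ≤ Real.exp (M * N₁) := fun N₁ =>
    Real.one_le_exp (mul_nonneg (hμ.trans hμM) (Nat.cast_nonneg _))
  -- the centred torus observables `FA = Â_c∘Θ'` (`[-T_A, T'_A]`-slab), `FB = B̂_c`
  set FA : GaugeConfig 4 (2 * S + 1) G → ℝ := fun U =>
    toTorusObservable (2 * S + 1) A.F U.negReflect -
      wilsonExpectation ρ β (toTorusObservable (2 * S + 1) A.F) with hFA
  set FB : GaugeConfig 4 (2 * S + 1) G → ℝ := fun U =>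
    toTorusObservable (2 * S + 1) B.F U -
      wilsonExpectation ρ β (toTorusObservable (2 * S + 1) B.F) with hFB
  have hAm : Measurable FA :=
    ((A.measurable.comp (measurable_torusLift (2 * S + 1))).comp
      WilsonSiteRP.measurable_negReflect).sub_const _
  have hBm : Measurable FB := (B.measurable.comp (measurable_torusLift (2 * S + 1))).sub_const _
  have hAb : ∃ C : ℝ, ∀ U, |FA U| ≤ C :=
    ⟨a0 + |wilsonExpectation ρ β (toTorusObservable (2 * S + 1) A.F)|, fun U =>
      (abs_sub _ _).trans (by gcongr; rw [toTorusObservable_apply]; exact ha0 _)⟩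
  have hBb : ∃ C : ℝ, ∀ U, |FB U| ≤ C :=
    ⟨b0 + |wilsonExpectation ρ β (toTorusObservable (2 * S + 1) B.F)|, fun U =>
      (abs_sub _ _).trans (by gcongr; rw [toTorusObservable_apply]; exact hb0 _)⟩
  have hAs : DependsOn FA (slabEdges TA TA') :=
    dependsOn_toTorusObservable_negReflect_slab (by omega) (by omega) hS1 A hA _
  have hBs : DependsOn FB (slabEdges TB' TB) :=
    dependsOn_toTorusObservable_slab (by omega) (by omega) B hB _
  -- the three endpoint bounds for `FA`: indices `2T_A + 1`, `S`, `S + 1`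
  have hloA : osPairingSeq ρ β FA FA (2 * TA + 1) ≤ KA * θ ^ (2 * TA + 1) := by
    have h := (le_abs_self _).trans (abs_latticeConnectedCorr_le ρ hρ β S A
      A.timeReflect ha0 ha0' (2 * TA + 1))
    rw [← osPairingSeq_centred_negReflect_eq ρ hρ] at h
    exact le_K_low haa h (hlow le_rfl)
  have hm0A : osPairingSeq ρ β FA FA S ≤ KA * θ ^ S := by
    have h := hA2
    rw [hθpow, ← osPairingSeq_centred_negReflect_eq ρ hρ] at h
    exact le_K_mid haa (hE1 _) hθS h
  have hm1A : osPairingSeq ρ β FA FA (S + 1) ≤ KA * θ ^ (S + 1) := by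
    have h := hA1
    rw [hθpow, ← osPairingSeq_centred_negReflect_succ_eq ρ hρ] at h
    have h1 := hlow (N₁ := 2 * TA + 1) (j := 1) (by omega)
    rw [pow_one] at h1
    rw [pow_succ]
    exact le_K_succ haa h1 hθS h
  -- the three endpoint bounds for `FB`: indices `2T'_B + 1`, `S`, `S + 1`
  have hloB : osPairingSeq ρ β FB FB (2 * TB' + 1) ≤ KB * θ ^ (2 * TB' + 1) := by
    have h := (le_abs_self _).trans (abs_latticeConnectedCorr_le ρ hρ β S
      B.timeReflect B hb0' hb0 (2 * TB' + 1))
    rw [← osPairingSeq_centred_eq ρ hρ] at h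
    exact le_K_low hbb h (hlow le_rfl)
  have hm0B : osPairingSeq ρ β FB FB S ≤ KB * θ ^ S := by
    have h := hB1
    rw [hθpow, ← osPairingSeq_centred_eq ρ hρ] at h
    exact le_K_mid hbb (hE1 _) hθS h
  have hm1B : osPairingSeq ρ β FB FB (S + 1) ≤ KB * θ ^ (S + 1) := by
    have h := hB2
    rw [hθpow, ← osPairingSeq_centred_succ_eq ρ hρ] at h
    have h1 := hlow (N₁ := 2 * TB' + 1) (j := 1) (by omega)
    rw [pow_one] at h1
    rw [pow_succ]
    exact le_K_succ hbb h1 hθS h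
  -- all odd-index diagonal bounds (part 9)
  have hoddA : ∀ j, Odd j → 2 * TA + 1 ≤ j → j ≤ S + 1 →
      osPairingSeq ρ β FA FA j ≤ KA * θ ^ j := fun j hj h1 h2 =>
    osPairingSeq_odd_le_of_endpoints ρ rfl hρ hβ hAm hAb hAs (by omega) (by omega) hθ hloA
      hm0A hm1A hj h1 h2
  have hoddB : ∀ j, Odd j → 2 * TB' + 1 ≤ j → j ≤ S + 1 →
      osPairingSeq ρ β FB FB j ≤ KB * θ ^ j := fun j hj h1 h2 =>
    osPairingSeq_odd_le_of_endpoints ρ rfl hρ hβ hBm hBb hBs (by omega) (by omega) hθ hloB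
      hm0B hm1B hj h1 h2
  -- conclude: OS Schwarz for `n ≥ 2(T_A + T'_B) + 2`, the trivial bound below
  rw [hθpow]
  have hθn : 0 ≤ θ ^ n := pow_nonneg hθ.le _
  by_cases hnA : 2 * (TA + TB') + 2 ≤ n
  · have hmix := osPairingSeq_mixed_abs_le ρ rfl hρ hβ hAm hAb hAs hBm hBb hBs (by omega)
      (by omega) hθ hoddA hoddB (n := n) (by omega) (by omega) hn
    rw [latticeConnectedCorr_eq_osPairingSeq ρ hρ]
    exact hmix.trans (mul_le_mul_of_nonneg_right (le_max_left _ _) hθn)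
  · push Not at hnA
    have hsmall := abs_latticeConnectedCorr_le ρ hρ β S A B ha0 hb0 n
    have hab : 0 ≤ 2 * (a0 * b0) := (abs_nonneg _).trans hsmall
    have h1 := hlow (N₁ := 2 * (TA + TB') + 2) (j := n) (by omega)
    calc |latticeConnectedCorr ρ β (2 * S + 1) A.F B.F n|
        ≤ 2 * (a0 * b0) := hsmall
      _ ≤ 2 * (a0 * b0) * (Real.exp (M * (2 * (TA + TB') + 2 : ℕ)) * θ ^ n) :=
          le_mul_of_one_le_right hab h1
      _ = 2 * (a0 * b0) * Real.exp (M * (2 * (TA + TB') + 2 : ℕ)) * θ ^ n := by ring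
      _ ≤ max (Real.sqrt (KA * KB)) (2 * (a0 * b0) * Real.exp (M * (2 * (TA + TB') + 2 : ℕ))) *
            θ ^ n :=
          mul_le_mul_of_nonneg_right (le_max_right _ _) hθn

/-! ## §2 The registered stub `stub_speciesToPairs` -/

/-- **STUB 3b of line `beta-slope-floor` — FROM REFLECTED ANTIPODAL DECAY OF EVERY SPECIES TO `GapInUnits`
(registered signature of the reshaped skeleton; its `ReflAntipodalDecay r a` δ-unfolded).**  For every compact
`G`, lattice representation `r` and unit map `a` with `a(β) → 0`: if there are `c₁ > 0`, `β₂`, `S₁` such that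
every species `A` has a constant `C_A` with
`c_{ΘA,A}(S; S), c_{A,ΘA}(S; S) ≤ C_A e^{−c₁ a(β) S}` for all `β ≥ β₂` and all `S ≥ S₁ β`
(`c_{X,Y}(n; S) = latticeConnectedCorr r.ρ β (2S+1) X Y n`, `ΘA = A.timeReflect`), then `GapInUnits G r a` holds
with the SAME rate `c₁` (per-pair constants; thresholds `β ≥ max β₂ β₃ 0` where `a ≤ 1` beyond `β₃`, `S ≥ S₁ β`).
Group-blind reflection-positivity plumbing (§1 on large tori, the trivial bound `2‖A‖‖B‖ e^{c₁ S_AB}` on tori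
smaller than the pair's slab heights `S_AB`); carries no gap content. -/
theorem stub_speciesToPairs : ∀ (G : Type) [Group G] [TopologicalSpace G] [IsTopologicalGroup G]
    [CompactSpace G] [MeasurableSpace G] [BorelSpace G] (r : LatticeRep G) (a : ℝ → ℝ),
    (∀ β, 0 < a β) → Tendsto a atTop (𝓝 0) →
    (∃ (c₁ β₂ : ℝ) (S₁ : ℝ → ℕ), 0 < c₁ ∧ ∀ A : YMSpecies G, ∃ C : ℝ, ∀ β : ℝ, β₂ ≤ β →
      ∀ S : ℕ, S₁ β ≤ S →
        latticeConnectedCorr r.ρ β (2 * S + 1) A.timeReflect.F A.F S ≤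
            C * Real.exp (-(c₁ * a β * S)) ∧
          latticeConnectedCorr r.ρ β (2 * S + 1) A.F A.timeReflect.F S ≤
            C * Real.exp (-(c₁ * a β * S))) →
    ∃ (c₁ β₂ : ℝ) (S₁ : ℝ → ℕ), 0 < c₁ ∧ ∀ A B : YMSpecies G, ∃ C : ℝ, ∀ β : ℝ, β₂ ≤ β →
      ∀ S n : ℕ, S₁ β ≤ S → n ≤ S →
        |latticeConnectedCorr r.ρ β (2 * S + 1) A.F B.F n| ≤ C * Real.exp (-(c₁ * a β * n)) := by
  intro G _ _ _ _ _ _ r a ha ha0 h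
  obtain ⟨c₁, β₂, S₁, hc₁, h⟩ := h
  -- `a β ≤ 1` for `β ≥ β₃`
  obtain ⟨β₃, hβ₃⟩ : ∃ β₃ : ℝ, ∀ β, β₃ ≤ β → a β ≤ 1 := by
    have hev : ∀ᶠ β in atTop, a β ≤ 1 :=
      (ha0.eventually (eventually_le_nhds zero_lt_one))
    exact eventually_atTop.1 hev
  refine ⟨c₁, max (max β₂ β₃) 0, S₁, hc₁, fun A B => ?_⟩
  obtain ⟨TA', TA, hA⟩ := exists_isSlabSupported A
  obtain ⟨TB', TB, hB⟩ := exists_isSlabSupported B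
  obtain ⟨CA, hCA⟩ := h A
  obtain ⟨CB, hCB⟩ := h B
  obtain ⟨a0, ha0'⟩ := A.bounded
  obtain ⟨b0, hb0'⟩ := B.bounded
  set S₀ : ℕ := 2 * (TA + TA' + TB + TB') + 2 with hS₀
  obtain ⟨K, hK⟩ := abs_latticeConnectedCorr_le_of_reflected_unif r.ρ r.continuous hA hB ha0' hb0'
    c₁ CA CB
  refine ⟨max K (2 * (a0 * b0) * Real.exp (c₁ * S₀)), fun β hβ S n hS hn => ?_⟩
  have hβ₂ : β₂ ≤ β := le_trans (le_max_left _ _) ((le_max_left _ _).trans hβ)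
  have hβ₃' : β₃ ≤ β := le_trans (le_max_right _ _) ((le_max_left _ _).trans hβ)
  have hβ0 : 0 ≤ β := (le_max_right _ _).trans hβ
  have haβ : 0 ≤ a β := (ha β).le
  have hμ : 0 ≤ c₁ * a β := mul_nonneg hc₁.le haβ
  have hμM : c₁ * a β ≤ c₁ := by
    have := mul_le_mul_of_nonneg_left (hβ₃ β hβ₃') hc₁.le
    simpa using this
  have hsmall := abs_latticeConnectedCorr_le r.ρ r.continuous β S A B ha0' hb0' n
  have hab : 0 ≤ 2 * (a0 * b0) := (abs_nonneg _).trans hsmall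
  have hexp_n : 0 ≤ Real.exp (-(c₁ * a β * n)) := (Real.exp_pos _).le
  have e1 : ∀ x : ℝ, c₁ * a β * x = (c₁ * a β) * x := fun x => by ring
  by_cases hS₀S : S₀ ≤ S
  · -- large torus: §1 with `μ = c₁ a β ≤ c₁`
    have hA1 := (hCA β hβ₂ S hS).1
    have hA2 := (hCA β hβ₂ S hS).2
    have hB1 := (hCB β hβ₂ S hS).1
    have hB2 := (hCB β hβ₂ S hS).2
    rw [e1] at hA1 hA2 hB1 hB2
    have hfin := hK β hβ0 (c₁ * a β) hμ hμM S hS₀S hA1 hA2 hB1 hB2 n hn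
    rw [← e1] at hfin
    exact hfin.trans (mul_le_mul_of_nonneg_right (le_max_left _ _) hexp_n)
  · -- small torus: trivial bound, `n ≤ S < S₀`, `c₁ a β n ≤ c₁ S₀`
    push Not at hS₀S
    have h1 : (1 : ℝ) ≤ Real.exp (c₁ * S₀) * Real.exp (-(c₁ * a β * n)) := by
      rw [← Real.exp_add]
      apply Real.one_le_exp
      have hnS₀ : (n : ℝ) ≤ S₀ := by exact_mod_cast (hn.trans hS₀S.le)
      have : c₁ * a β * n ≤ c₁ * S₀ := by
        calc c₁ * a β * n ≤ c₁ * 1 * n := by gcongr; exact hβ₃ β hβ₃'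
          _ = c₁ * n := by ring
          _ ≤ c₁ * S₀ := mul_le_mul_of_nonneg_left hnS₀ hc₁.le
      linarith
    calc |latticeConnectedCorr r.ρ β (2 * S + 1) A.F B.F n|
        ≤ 2 * (a0 * b0) := hsmall
      _ ≤ 2 * (a0 * b0) * (Real.exp (c₁ * S₀) * Real.exp (-(c₁ * a β * n))) :=
          le_mul_of_one_le_right hab h1
      _ = 2 * (a0 * b0) * Real.exp (c₁ * S₀) * Real.exp (-(c₁ * a β * n)) := by ring
      _ ≤ max K (2 * (a0 * b0) * Real.exp (c₁ * S₀)) * Real.exp (-(c₁ * a β * n)) :=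
          mul_le_mul_of_nonneg_right (le_max_right _ _) hexp_n

end Summit.QuantumFields.YangMills.Cruxes.IR.BetaSlopeFloor

end
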